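import Summits.ResolutionOfSingularities.ResolutionOfSingularities.Theorems.WeightedInvariantRatContactEssSmooth
import Summits.ResolutionOfSingularities.ResolutionOfSingularities.Theorems.WeightedInvariantJFlatEssSmoothTangent
import HarnessLib

/-!
# One-member (σ-ratio) descent, brick 2b — the two correction steps of GAP 1″ with the hypothesis on the irrational parameter
# weakened to «reaches SOME rational slope above the current integer level» (door `HypersurfaceCentreConstruction`,
# stmt-ResolutionOfSingularities-19897; P3 rung; (o53-desc′) PART 1; hand res-L1-w43-stub-3)

Topic: `Summits/ResolutionOfSingularities/ResolutionOfSingularities/Theorems`. Helper for the door item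
`HypersurfaceCentreConstruction` (stmt-ResolutionOfSingularities-19897, route `WeightedInvariant`), line `local-engine` (L W4.3),
def-free.  GAP 1″ (p554295 `JFlatEssSmooth.exists_correction_one`, p553232 `JFlatEssSmooth.exists_correction_of_two_le`) corrects a
rational contact parameter `y` of integer level `b` along a local formally smooth `φ : S → S'` (`𝔪S' = 𝔪'`, `dim S' = 3`) when an
irrational `g'` reaches the integer level `b + 1`.  The induction on the NUMERATOR of a rational slope `a/b'` (brick 2c) needs the
same corrections when `g'` only reaches a rational slope `a'/b' > b` — the two uses of the level-`b+1` hypothesis in GAP 1″ (the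
normalisation `g' ≡ u₀ φy (mod 𝔪'^b)` and the face reading `φf ≡ a g₁^ν (mod F_{g₁,b}(bν+1))`) are supplied instead by C2 at
rational slope (p563278 `RatContactCanonical.exists_unit_sub_mul_mem_pow_of_mem_ratContactFiltration`) and by
`RatContactEssSmooth.mem_span_pow_sup_of_ratContact_gt`; the rest of both proofs is VERBATIM GAP 1″:

* `exists_correction_one_of_ratContact` (level 1 → slope `a'/b' > 1`: tangent direction, (F4) at `d = 1`),
* `exists_correction_of_two_le_of_ratContact` (level `b ≥ 2` → slope `a'/b' > b`: the weighted face identity, (F4) at `d = b`).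

[OURS · L1 W4.3 · (o53-desc′) PART 1]  Replaces the role of NO printed item; NOT a statement of the manuscript
[claim: Hironaka2017, status: under-review]. AI work, weaker than expert review.  Named facts used (through p548127 only):
`Literature.FormallySmoothField.{formallySmooth_iff_separable (F2), essFiniteType_iff_fg (F3), exists_pthRoot_of_adjoin_pow_eq_top (F4)}`.

## References

* H. Hironaka, *Characteristic polyhedra of singularities*, J. Math. Kyoto Univ. 7 (1967), §3. [Hironaka1967]
* V. Cossart, U. Jannsen, S. Saito, *Desingularization*, LNM 2270 (2020), Lemma 8.3. [CossartJannsenSaito2020]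
* A. Grothendieck, *EGA IV*, Publ. Math. IHÉS 20 (1964), 0_IV (19.6.1), (21.2.7), (17.5.1). [EGA0IV]
-/

noncomputable section

open IsLocalRing MvPolynomial Literature.AlgebraicGeometry.Resolution
open Summit.ResolutionOfSingularities.ResolutionOfSingularities.Cruxes.HypersurfaceCentreConstruction.LocalEngine
open Summit.ResolutionOfSingularities.ResolutionOfSingularities.Cruxes.HypersurfaceCentreConstruction.LocalEngine.Iota3.RatContact

set_option linter.dupNamespace false -- mandated namespace of this single-conjunct summit

namespace Summit.ResolutionOfSingularities.ResolutionOfSingularities.Theorems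

namespace JFlatEssSmooth

open IotaOrderEssSmooth (mem_maximalIdeal_pow_iff_of_formallySmooth)

section Descent

variable {S S' : Type} [CommRing S] [CommRing S'] [IsRegularLocalRing S] [IsRegularLocalRing S'] [Algebra S S']
  [IsLocalHom (algebraMap S S')] [Algebra.FormallySmooth S S'] [Algebra.EssFiniteType S S']

/-- **GAP 1″ at `b = 1`, rational-slope form**: as `exists_correction_one` (p554295) with the hypothesis «`g'` carries `φ f` to
level `2`» weakened to «`g'` carries `φ f` to SOME rational weight `a'/b' > 1`» (`φf ∈ ratContactFiltration g' a' b' (a'ν)`,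
`b' < a'`): then `g' ≡ u · φ(y + r) (mod 𝔪'²)` with `r ∈ 𝔪_S`, `y + r ∉ 𝔪_S²`, `u` a unit.  Only Step B changes (the tangent-cone
dichotomy `exists_sub_mul_pow_mem_of_mem_ratContactFiltration` of p560066 replaces the level-2 reading).
[cite: Hironaka1967, §3] [OURS · L1 W4.3 · (o53-desc′) PART 1] -/
theorem exists_correction_one_of_ratContact (h𝔪 : (maximalIdeal S).map (algebraMap S S') = maximalIdeal S')
    (hdim' : ringKrullDim S' = 3) (c : Fin 3 → S) (hgen : Ideal.span {c 0, c 1, c 2} = maximalIdeal S)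
    {f : S} {ν : ℕ} (hν : 1 ≤ ν) (hford : f ∉ maximalIdeal S ^ (ν + 1)) (hfν : f ∈ maximalIdeal S ^ ν)
    {g' : S'} (hg' : g' ∈ maximalIdeal S')
    (hl : g' ∉ Ideal.span {algebraMap S S' (c 1), algebraMap S S' (c 2)} ⊔ maximalIdeal S' ^ 2)
    {a' b' : ℕ} (hb' : 0 < b') (hslope : b' < a') (hfg' : algebraMap S S' f ∈ ratContactFiltration g' a' b' (a' * ν)) :
    ∃ (r : S) (u : S'), r ∈ maximalIdeal S ∧ c 0 + r ∉ maximalIdeal S ^ 2 ∧ IsUnit u ∧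
      g' - u * algebraMap S S' (c 0 + r) ∈ maximalIdeal S' ^ (1 + 1) := by
  classical
  haveI := FormallySmoothField.formallySmooth_residueField S S' h𝔪
  haveI := FormallySmoothField.essFiniteType_residueField S S'
  have h111 : (![1, 1, 1] : Fin 3 → ℕ) = fun _ => 1 := by funext i; fin_cases i <;> rfl
  have hgenr : Ideal.span (Set.range c) = maximalIdeal S := span_range_eq_of_span_triple c hgen
  have hci : ∀ i, c i ∈ maximalIdeal S := fun i => hgenr ▸ Ideal.subset_span ⟨i, rfl⟩
  have hc'i : ∀ i, (algebraMap S S' ∘ c) i ∈ maximalIdeal S' := fun i => h𝔪 ▸ Ideal.mem_map_of_mem _ (hci i)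
  have hgen' : Ideal.span {algebraMap S S' (c 0), algebraMap S S' (c 1), algebraMap S S' (c 2)} = maximalIdeal S' := by
    rw [← h𝔪, ← hgen, Ideal.map_span, Set.image_insert_eq, Set.image_insert_eq, Set.image_singleton]
  have hgen'3 : Ideal.span {(algebraMap S S' ∘ c) 0, (algebraMap S S' ∘ c) 1, (algebraMap S S' ∘ c) 2} =
      maximalIdeal S' := hgen'
  have hgen'r : Ideal.span (Set.range (algebraMap S S' ∘ c)) = maximalIdeal S' :=
    span_range_eq_of_span_triple _ hgen'3
  have hwpos : ∀ i, 0 < (![1, 1, 1] : Fin 3 → ℕ) i := fun i => by rw [h111]; exact Nat.one_pos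
  have hW : ∀ n, weightedIdealW c ![1, 1, 1] n = maximalIdeal S ^ n := fun n => by
    rw [h111]; exact weightedIdealW_one_eq_pow c hgenr n
  have hW' : ∀ n, weightedIdealW (algebraMap S S' ∘ c) ![1, 1, 1] n = maximalIdeal S' ^ n := fun n => by
    rw [h111]; exact weightedIdealW_one_eq_pow _ hgen'r n
  have hford' : algebraMap S S' f ∉ maximalIdeal S' ^ (ν + 1) := fun h =>
    hford ((mem_maximalIdeal_pow_iff_of_formallySmooth S S' _ f).mpr h)
  -- Step B: `φ f = a g'^ν + h`, `h ∈ 𝔪'^{ν+1}`, `a` a unit (tangent-cone dichotomy at slope `a'/b' > 1`)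
  obtain ⟨a, hah⟩ := exists_sub_mul_pow_mem_of_mem_ratContactFiltration hg' hb' hslope hfg'
  set h : S' := algebraMap S S' f - a * g' ^ ν with hhdef
  have hh' : h ∈ maximalIdeal S' ^ (ν + 1) := hah
  have hsum : a * g' ^ ν + h = algebraMap S S' f := by rw [hhdef]; ring
  have ha : IsUnit a := by
    by_contra hau
    apply hford'
    have h1 : a * g' ^ ν ∈ maximalIdeal S' ^ (ν + 1) := by
      rw [pow_succ']
      exact Ideal.mul_mem_mul ((IsLocalRing.mem_maximalIdeal a).mpr hau) (Ideal.pow_mem_pow hg' ν)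
    rw [← hsum]
    exact Ideal.add_mem _ h1 hh'
  have ha0 : residue S' a ≠ 0 := fun h0 =>
    (IsLocalRing.mem_maximalIdeal a).mp ((residue_eq_zero_iff a).mp h0) ha
  -- `in_1(g') = L`, a linear form `l₀ Y + l₁ U₁ + l₂ U₂`
  obtain ⟨L, hL⟩ := exists_isInForm_of_mem (algebraMap S S' ∘ c) ![1, 1, 1] (n := 1) (f := g')
    (by rw [hW', pow_one]; exact hg')
  obtain ⟨F, hFhom, hFL, hFrem⟩ := hL
  have hin_g' : IsInForm (algebraMap S S' ∘ c) ![1, 1, 1] 1 g' L := ⟨F, hFhom, hFL, hFrem⟩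
  have hFlin := eq_linear_of_isWeightedHomogeneous_one hFhom
  set F₀ := F.coeff (Finsupp.single 0 1) with hF₀
  set F₁ := F.coeff (Finsupp.single 1 1) with hF₁
  set F₂ := F.coeff (Finsupp.single 2 1) with hF₂
  have hLlin : L = C (residue S' F₀) * X 0 + C (residue S' F₁) * X 1 + C (residue S' F₂) * X 2 := by
    rw [← hFL, hFlin]
    simp [map_X, map_C]
  -- `F₀` is a unit: otherwise `g' ∈ (φ x₁, φ x₂) + 𝔪'²`
  have hF₀u : IsUnit F₀ := by
    by_contra hnu
    have hF₀m : F₀ ∈ maximalIdeal S' := (IsLocalRing.mem_maximalIdeal _).mpr hnu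
    apply hl
    have heval : eval (algebraMap S S' ∘ c) F =
        F₀ * algebraMap S S' (c 0) + F₁ * algebraMap S S' (c 1) + F₂ * algebraMap S S' (c 2) := by
      conv_lhs => rw [hFlin]
      simp [eval_C, eval_X]
    have hrem : g' - eval (algebraMap S S' ∘ c) F ∈ maximalIdeal S' ^ 2 := by
      rw [← hW']; exact hFrem
    have hsplit : g' = (F₁ * algebraMap S S' (c 1) + F₂ * algebraMap S S' (c 2)) +
        ((g' - eval (algebraMap S S' ∘ c) F) + F₀ * algebraMap S S' (c 0)) := by
      rw [heval]; ring
    rw [hsplit]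
    refine Submodule.add_mem_sup ?_ (Ideal.add_mem _ hrem ?_)
    · exact Ideal.add_mem _ (Ideal.mul_mem_left _ _ (Ideal.subset_span (by simp)))
        (Ideal.mul_mem_left _ _ (Ideal.subset_span (by simp)))
    · rw [pow_two]
      exact Ideal.mul_mem_mul hF₀m (hc'i 0)
  have hl0 : residue S' F₀ ≠ 0 := fun h0 =>
    (IsLocalRing.mem_maximalIdeal _).mp ((residue_eq_zero_iff _).mp h0) hF₀u
  -- `in_ν(φ f) = ā L^ν = in_ν(f) ⊗ κ(S')`
  have hin_rhs : IsInForm (algebraMap S S' ∘ c) ![1, 1, 1] ν (algebraMap S S' f) (C (residue S' a) * L ^ ν) := by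
    have h1 := IsInForm.smul _ (IsInForm.pow (algebraMap S S' ∘ c) hin_g' ν) a
    rw [one_mul] at h1
    have h2 : IsInForm (algebraMap S S' ∘ c) ![1, 1, 1] ν h 0 :=
      isInForm_zero_of_mem_succ _ (by rw [hW']; exact hh')
    have h3 := IsInForm.add _ h1 h2
    rw [add_zero, hsum] at h3
    exact h3
  obtain ⟨P, hP⟩ := exists_isInForm_of_mem c ![1, 1, 1] (n := ν) (f := f) (by rw [hW]; exact hfν)
  have hin_lhs : IsInForm (algebraMap S S' ∘ c) ![1, 1, 1] ν (algebraMap S S' f)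
      (MvPolynomial.map (algebraMap (ResidueField S) (ResidueField S')) P) := IsInForm.baseChange hP
  have hPQ := IsInForm.unique _ hgen'3 hdim' hwpos hin_lhs hin_rhs
  -- normal form `L = l₀ (Y + R)`, `R = (l₁/l₀) U₁ + (l₂/l₀) U₂`
  set l₀ := residue S' F₀ with hl₀
  set R : MvPolynomial (Fin 3) (ResidueField S') :=
    C (residue S' F₁ / l₀) * X 1 + C (residue S' F₂ / l₀) * X 2 with hRdef
  have hLR : L = C l₀ * (X 0 + R) := by
    rw [hLlin, hRdef, mul_add, mul_add, ← mul_assoc, ← mul_assoc, ← C_mul, ← C_mul,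
      mul_div_cancel₀ _ hl0, mul_div_cancel₀ _ hl0, add_assoc]
  have hRface : ∀ m ∈ R.support, m 0 = 0 ∧ m 1 + m 2 = 1 := by
    intro m hm
    rw [mem_support_iff, hRdef] at hm
    simp only [coeff_add, coeff_C_mul, coeff_X, mul_ite, mul_one, mul_zero] at hm
    by_cases h1 : Finsupp.single (1 : Fin 3) 1 = m
    · subst h1; simp
    by_cases h2 : Finsupp.single (2 : Fin 3) 1 = m
    · subst h2; simp
    rw [if_neg h1, if_neg h2, add_zero] at hm
    exact absurd rfl hm
  have hPQ' : MvPolynomial.map (algebraMap (ResidueField S) (ResidueField S')) P =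
      C (residue S' a * l₀ ^ ν) * (X 0 + R) ^ ν := by
    rw [hPQ, hLR, mul_pow, ← C_pow, ← mul_assoc, ← C_mul]
  have hal0 : residue S' a * l₀ ^ ν ≠ 0 := mul_ne_zero ha0 (pow_ne_zero _ hl0)
  -- Step C (`d = 1`): `R` is rational; Step D: lift it to `r ∈ (x₁, x₂)`
  obtain ⟨R₀, hR₀⟩ :=
    exists_eq_map_of_face_identity (ResidueField S) (ResidueField S') hν hal0 hRface hPQ'
  obtain ⟨r, hr1, hin_r⟩ := exists_eval_isInForm_of_polynomial c (hci 1) (hci 2) 1 1 R₀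
  have hr𝔪 : r ∈ maximalIdeal S := by rwa [pow_one] at hr1
  have hin_φr : IsInForm (algebraMap S S' ∘ c) ![1, 1, 1] 1 (algebraMap S S' r) R := by
    have := IsInForm.baseChange (T := S') hin_r
    rwa [← hR₀] at this
  have hin_y : IsInForm (algebraMap S S' ∘ c) ![1, 1, 1] 1 (algebraMap S S' (c 0)) (X 0) :=
    isInForm_coord_zero (algebraMap S S' ∘ c) ![1, 1, 1]
  have hin_corr : IsInForm (algebraMap S S' ∘ c) ![1, 1, 1] 1 (F₀ * algebraMap S S' (c 0 + r)) L := by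
    have := IsInForm.smul _ (IsInForm.add _ hin_y hin_φr) F₀
    rw [← hl₀, ← hLR, ← map_add] at this
    exact this
  -- Step E: `g' - F₀ φ(y + r) ∈ 𝔪'²`
  have hdiff : g' - F₀ * algebraMap S S' (c 0 + r) ∈ maximalIdeal S' ^ (1 + 1) := by
    have := IsInForm.sub _ hin_g' hin_corr
    rw [sub_self] at this
    rw [← hW']
    exact IsInForm.mem_succ_of_zero _ hgen'r hwpos this
  refine ⟨r, F₀, hr𝔪, ?_, hF₀u, hdiff⟩
  intro h2
  apply hl
  refine Submodule.mem_sup_right ?_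
  have hsplit : g' = (g' - F₀ * algebraMap S S' (c 0 + r)) + F₀ * algebraMap S S' (c 0 + r) := by ring
  rw [hsplit]
  refine Ideal.add_mem _ hdiff (Ideal.mul_mem_left _ _ ?_)
  have := Ideal.mem_map_of_mem (algebraMap S S') h2
  rwa [Ideal.map_pow, h𝔪] at this

/-- **GAP 1″ at `b ≥ 2`, rational-slope form**: as `exists_correction_of_two_le` (p553232) with the hypothesis «`g'` carries `φ f`
to level `b + 1`» weakened to «`g'` carries `φ f` to SOME rational weight `a'/b' > b`» (`φf ∈ ratContactFiltration g' a' b' (a'ν)`,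
`b·b' < a'`): then `g' ≡ u · φ(y + r) (mod 𝔪'^{b+1})`, `r ∈ 𝔪_S`, `y + r ∉ 𝔪_S²`, `u` a unit.  Step A (normalisation) is C2 at
the rational slope `(b·b')/b'` (p563278), Step B reads the face through `mem_span_pow_sup_of_ratContact_gt`; Steps C–F verbatim.
[cite: Hironaka1967, §3] [cite: CossartJannsenSaito2020, Lemma 8.3] [OURS · L1 W4.3 · (o53-desc′) PART 1] -/
theorem exists_correction_of_two_le_of_ratContact (h𝔪 : (maximalIdeal S).map (algebraMap S S') = maximalIdeal S')
    (hdim' : ringKrullDim S' = 3) (c : Fin 3 → S) (hgen : Ideal.span {c 0, c 1, c 2} = maximalIdeal S)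
    (hy2 : c 0 ∉ maximalIdeal S ^ 2) {f : S} {ν b : ℕ} (hν : 1 ≤ ν) (hb : 2 ≤ b)
    (hford : f ∉ maximalIdeal S ^ (ν + 1)) (hfy : f ∈ contactFiltration (c 0) b (b * ν)) {g' : S'}
    (hg' : g' ∈ maximalIdeal S') (hg'2 : g' ∉ maximalIdeal S' ^ 2)
    {a' b' : ℕ} (hb' : 0 < b') (hslope : b * b' < a')
    (hfg' : algebraMap S S' f ∈ ratContactFiltration g' a' b' (a' * ν)) :
    ∃ (r : S) (u : S'), r ∈ maximalIdeal S ∧ c 0 + r ∉ maximalIdeal S ^ 2 ∧ IsUnit u ∧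
      g' - u * algebraMap S S' (c 0 + r) ∈ maximalIdeal S' ^ (b + 1) := by
  classical
  haveI := FormallySmoothField.formallySmooth_residueField S S' h𝔪
  haveI := FormallySmoothField.essFiniteType_residueField S S'
  have hb1 : 1 ≤ b := le_trans one_le_two hb
  -- the two coordinate systems
  have hc3 : ![c 0, c 1, c 2] = c := by funext i; fin_cases i <;> rfl
  have hc'3 : ![algebraMap S S' (c 0), algebraMap S S' (c 1), algebraMap S S' (c 2)] = algebraMap S S' ∘ c := by
    funext i; fin_cases i <;> rfl
  have hgenr : Ideal.span (Set.range c) = maximalIdeal S := span_range_eq_of_span_triple c hgen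
  have hci : ∀ i, c i ∈ maximalIdeal S := fun i => hgenr ▸ Ideal.subset_span ⟨i, rfl⟩
  have hc'i : ∀ i, (algebraMap S S' ∘ c) i ∈ maximalIdeal S' := fun i => h𝔪 ▸ Ideal.mem_map_of_mem _ (hci i)
  have hgen' : Ideal.span {algebraMap S S' (c 0), algebraMap S S' (c 1), algebraMap S S' (c 2)} = maximalIdeal S' := by
    rw [← h𝔪, ← hgen, Ideal.map_span, Set.image_insert_eq, Set.image_insert_eq, Set.image_singleton]
  have hgen'3 : Ideal.span {(algebraMap S S' ∘ c) 0, (algebraMap S S' ∘ c) 1, (algebraMap S S' ∘ c) 2} =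
      maximalIdeal S' := hgen'
  have hgen'r : Ideal.span (Set.range (algebraMap S S' ∘ c)) = maximalIdeal S' :=
    span_range_eq_of_span_triple _ hgen'3
  have hwpos : ∀ i, 0 < (![b, 1, 1] : Fin 3 → ℕ) i := fun i => by fin_cases i <;> (simp; try omega)
  have hφy : algebraMap S S' (c 0) ∈ maximalIdeal S' := hc'i 0
  have hφy2 : algebraMap S S' (c 0) ∉ maximalIdeal S' ^ 2 := fun h =>
    hy2 ((mem_maximalIdeal_pow_iff_of_formallySmooth S S' 2 (c 0)).mpr h)
  have hford' : algebraMap S S' f ∉ maximalIdeal S' ^ (ν + 1) := fun h =>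
    hford ((mem_maximalIdeal_pow_iff_of_formallySmooth S S' _ f).mpr h)
  -- Step A: normalise `g' = u₀ (φ y + r₁)`, `r₁ ∈ 𝔪'^b`
  have hfy' : algebraMap S S' f ∈ contactFiltration (algebraMap S S' (c 0)) b (b * ν) :=
    (EssSmoothLevels.algebraMap_mem_contactFiltration_iff h𝔪 f (c 0) b _).mpr hfy
  -- both `φ y` and `g'` carry `φ f` to the rational weight `(b·b')/b' = b`: C2 at rational slope (p563278)
  have hbb' : b' < b * b' := by nlinarith
  have hceil : (b * b' + b' - 1) / b' = b := (RatContactEssSmooth.ceilDiv_succ_of_dvd hb' ⟨b, by ring⟩).2.trans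
    (by rw [Nat.mul_div_cancel _ hb'])
  have h₁ : algebraMap S S' f ∈ ratContactFiltration g' (b * b') b' (b * b' * ν) :=
    RatContactEssSmooth.ratContactFiltration_anti g' hslope.le b' ν hfg'
  have h₂ : algebraMap S S' f ∈ ratContactFiltration (algebraMap S S' (c 0)) (b * b') b' (b * b' * ν) := by
    rw [RatContactEssSmooth.ratContactFiltration_mul_eq_contactFiltration _ b hb' ν]; exact hfy'
  obtain ⟨u₀, hu₀'⟩ := RatContactCanonical.exists_unit_sub_mul_mem_pow_of_mem_ratContactFiltration hg' hg'2 hφy hφy2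
    hb' hbb' hν hford' h₁ h₂
  have hu₀ : g' - ↑u₀ * algebraMap S S' (c 0) ∈ maximalIdeal S' ^ b := by rwa [hceil] at hu₀'
  set r₁ : S' := ↑u₀⁻¹ * (g' - ↑u₀ * algebraMap S S' (c 0)) with hr₁
  have hr₁b : r₁ ∈ maximalIdeal S' ^ b := Ideal.mul_mem_left _ _ hu₀
  have hg₁ : (↑u₀⁻¹ : S') * g' = algebraMap S S' (c 0) + r₁ := by
    rw [hr₁, mul_sub, ← mul_assoc, Units.inv_mul, one_mul]
    ring
  have hg₁𝔪 : algebraMap S S' (c 0) + r₁ ∈ maximalIdeal S' := Ideal.add_mem _ hφy (Ideal.pow_le_self (by omega) hr₁b)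
  have hfg₁ : algebraMap S S' f ∈ ratContactFiltration (algebraMap S S' (c 0) + r₁) a' b' (a' * ν) := by
    rw [RatContactEssSmooth.ratContactFiltration_eq_of_sub_unit_mul_mem_pow (u₀⁻¹).isUnit hb'
      (show algebraMap S S' (c 0) + r₁ - ↑u₀⁻¹ * g' ∈ maximalIdeal S' ^ ((a' + b' - 1) / b') by
        rw [hg₁, sub_self]; exact zero_mem _)]
    exact hfg'
  -- the `(b,1,1)`-filtration of `c' = φ ∘ c` is the contact filtration of `φ y + r₁` at weight `b`
  have hW' : ∀ n, weightedIdealW (algebraMap S S' ∘ c) ![b, 1, 1] n =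
      contactFiltration (algebraMap S S' (c 0) + r₁) b n := fun n => by
    rw [← hc'3, weightedIdealW_eq_contactFiltration _ _ _ hgen' hb1 n]
    refine (contactFiltration_eq_of_sub_unit_mul_mem_pow isUnit_one ?_ n).symm
    rw [one_mul, add_sub_cancel_left]
    exact hr₁b
  -- Step B: the face of `φ f` read from `g₁ = φ y + r₁`
  obtain ⟨aν, haν, w₁, hw₁, hsum⟩ :=
    Submodule.mem_sup.mp (RatContactEssSmooth.mem_span_pow_sup_of_ratContact_gt (algebraMap S S' (c 0) + r₁)
      hb' hslope ν hfg₁)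
  obtain ⟨a, rfl⟩ := Ideal.mem_span_singleton'.mp haν
  have ha : IsUnit a := isUnit_of_level_face hg₁𝔪 hb1 hsum.symm hw₁ hford'
  have ha0 : residue S' a ≠ 0 := fun h =>
    (IsLocalRing.mem_maximalIdeal a).mp ((residue_eq_zero_iff a).mp h) ha
  obtain ⟨R, hR, hRface⟩ := exists_isInForm_face_of_mem_pow (algebraMap S S' ∘ c) hgen'r hb hr₁b
  have hin_g₁ : IsInForm (algebraMap S S' ∘ c) ![b, 1, 1] b (algebraMap S S' (c 0) + r₁) (X 0 + R) :=
    IsInForm.add _ (isInForm_coord_zero (algebraMap S S' ∘ c) ![b, 1, 1]) hR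
  have hin_rhs : IsInForm (algebraMap S S' ∘ c) ![b, 1, 1] (b * ν) (algebraMap S S' f)
      (C (residue S' a) * (X 0 + R) ^ ν) := by
    have h1 := IsInForm.smul _ (IsInForm.pow (algebraMap S S' ∘ c) hin_g₁ ν) a
    have h2 : IsInForm (algebraMap S S' ∘ c) ![b, 1, 1] (b * ν) w₁ 0 :=
      isInForm_zero_of_mem_succ _ (by rw [hW']; exact hw₁)
    have h3 := IsInForm.add _ h1 h2
    rw [add_zero, hsum] at h3
    exact h3
  -- the same face read from `S`
  have hfW : f ∈ weightedIdealW c ![b, 1, 1] (b * ν) := by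
    rw [← hc3, weightedIdealW_eq_contactFiltration _ _ _ hgen hb1]
    exact hfy
  obtain ⟨P, hP⟩ := exists_isInForm_of_mem c ![b, 1, 1] hfW
  have hin_lhs : IsInForm (algebraMap S S' ∘ c) ![b, 1, 1] (b * ν) (algebraMap S S' f)
      (MvPolynomial.map (algebraMap (ResidueField S) (ResidueField S')) P) := IsInForm.baseChange hP
  have hPQ := IsInForm.unique _ hgen'3 hdim' hwpos hin_lhs hin_rhs
  -- Step C: the form `R` is rational
  obtain ⟨R₀, hR₀⟩ := exists_eq_map_of_face_identity (ResidueField S) (ResidueField S') hν ha0 hRface hPQ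
  -- Step D: lift to `S`
  obtain ⟨r, hrb, hin_r⟩ := exists_eval_isInForm_of_polynomial c (hci 1) (hci 2) b b R₀
  have hr𝔪 : r ∈ maximalIdeal S := Ideal.pow_le_self (by omega) hrb
  have hφrb : algebraMap S S' r ∈ maximalIdeal S' ^ b := by
    have := Ideal.mem_map_of_mem (algebraMap S S') hrb
    rwa [Ideal.map_pow, h𝔪] at this
  have hin_φr : IsInForm (algebraMap S S' ∘ c) ![b, 1, 1] b (algebraMap S S' r) R := by
    have := IsInForm.baseChange (T := S') hin_r
    rwa [← hR₀] at this
  -- Step E: `r₁ - φ r ∈ F'_{b+1}`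
  have hdiff : r₁ - algebraMap S S' r ∈ weightedIdealW (algebraMap S S' ∘ c) ![b, 1, 1] (b + 1) := by
    have := IsInForm.sub _ hR hin_φr
    rw [sub_self] at this
    exact IsInForm.mem_succ_of_zero _ hgen'r hwpos this
  rw [← hc'3] at hdiff
  -- Step F: the unit
  obtain ⟨u, hu, hcong⟩ := exists_unit_correction_of_mem_weightedIdealW_succ hgen' hφy2 hb hr₁b hφrb hdiff
  refine ⟨r, ↑u₀ * u, hr𝔪, ?_, u₀.isUnit.mul hu, ?_⟩
  · intro h
    apply hy2
    have : c 0 = (c 0 + r) - r := by ring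
    rw [this]
    exact Ideal.sub_mem _ h (Ideal.pow_le_pow_right hb hrb)
  · have key : g' - ↑u₀ * u * algebraMap S S' (c 0 + r) =
        ↑u₀ * ((algebraMap S S' (c 0) + r₁) - u * (algebraMap S S' (c 0) + algebraMap S S' r)) := by
      rw [← hg₁, map_add, mul_sub, ← mul_assoc, Units.mul_inv, one_mul]
      ring
    rw [key]
    exact Ideal.mul_mem_left _ _ hcong

end Descent

end JFlatEssSmooth

end Summit.ResolutionOfSingularities.ResolutionOfSingularities.Theorems

end
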